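import Summits.QuantumFields.BalabanUV.Beta.FP.TorusCompositeInsertionPeriodicSym
import Summits.QuantumFields.BalabanUV.Beta.FP.TorusStepInsertionPeriodicTwo
import Summits.QuantumFields.BalabanUV.Beta.FP.TorusCompositeInsertionKernel

/-!
# `BalabanUV.Beta.FP.TorusCompositeInsertionKernelSym` — road «FP» for binder row D1, ROUTE T, (β1) «sym» column: **THE KERNEL-LEVEL (S3-2) FORM OF THE ORDER-1 SYM
# COMPOSITE JUNCTION — `compIns₁Sym … n h` IS THE `h`-WEIGHTED PERIODISATION `Σ_b h b • perF T (dper T (𝒱 b))` OF ANY BLOCK-COVARIANT WINDOWED LATTICE FAMILY `𝒱`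
# WHOSE BORDER ENTRIES ARE A KERNEL OF THE FUNCTIONAL `𝓘`** (the (β1) twin of `TorusCompositeInsertionKernel`; the shape the `-Sym` door's 𝔔-side binding
# `hQF₁ : Q₁₁f (dv k) = VF.submatrix fF ff` reads, `VF := perF T (dper T (𝒱_F …))`)

WHY.  `TorusCompositeInsertionPeriodicSym` identifies the ACTION of OUR sym composite first-order insertion jet on finest-periodic forms with any functional `𝓘` obeying
our sym chain rule over any rows functional `𝓡` obeying the sym one-step law (clauses `hR0 ∕ hRsucc ∕ h0 ∕ hsucc`), and its §4 `compIns₁Sym_apply_eq` reads off the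
ENTRIES at periodic bond indicators.  The (S3-2) namings bind a torus MATRIX `VF = perF T (dper T 𝒱)`.  THIS FILE closes the gap for ANY lattice family
`𝒱 κ′ u : MKer` (indexed by the background bond) that is block-covariant at the tower's blocking `Lc^n` (`hVt`), windowed in the fluctuation slot and in the family
bond (`hS ∕ hT`), and whose `(inr κ, inl l)` entries at the coarse multiplier sites `Lc^n • x̄` are a KERNEL of `𝓘 lev n`
(`h𝒱 : Σ'_u Σ_{κ′} (Σ'_z Σ_l 𝒱 κ′ u (Lc^n • x̄) z (inr κ) (inl l) · B l z) · H κ′ u = 𝓘 lev n H B κ x̄` for all forms `H, B`): then, ENTRYWISE, at the centred tower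
(`hc : ctrOff (d+1) Lc ∈ box (d+1) Lc`) and every root list `rs`,
`Σ_b h b · perZ T (dper T (𝒱 b.2 b.1)) (Lc^n • x̄) z (inr κ) (inl β) = compIns₁Sym Lc M lev rs n h (x̄, κ) (z, β)`.  No lattice object is DEFINED; `𝒱`, `𝓡`, `𝓘` are
the row's.  The proof is the rooted file's, line for line; only its last two steps (`h𝒱`, `compIns₁Sym_apply_eq`) see the functional.

[folklore] finite sums + finitely supported `tsum` re-indexing BY NAME (`PeriodisedBorderTables.dper_apply_of_blockCov`, `TorusStepInsertionPeriodicTwo`'s lift engine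
`sum_mul_tsum_translate_eq_tsum_lift`, `tsum_sites_eq_sum_tsum`, `compIns₁Sym_apply_eq`); §1 `tsum_mul_indicator_wrap` is a copy of the rooted file's §1 (not yet
importable); no `def`, no `def … : Prop`, nothing cited, 0 sorry; NO chart; nothing of Bałaban's asserted.  NOT HERE: the row's `𝒱` and the proof that its border
entries are a kernel of the row's `𝓘` — that identity IS the (C1) TABLE word at order 1; order 2 likewise on word.

HONEST DEPENDENCY (page 1, mandatory): continuum YM on T⁴ ⇐ BetaPertH ∧ nine spine estimates (0/9 proved); BetaPertH ⇐ (D1) ∧ (D4) ∧ CAP+tail;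
G-an2-4 gates asym, D1 and NE2/3/4.  HONEST FRAMING (cell contract, verbatim): «discharging `BetaPertH` makes Bałaban's UV stability UNCONDITIONAL —
a real constructive-QFT result; it is NOT the continuum limit and NOT the Clay problem.»  ABSOLUTE RULE (cell charter, verbatim): «No internally-minted
statement may enter as a cited fact. Every hypothesis is either kernel-proved in this package or a verbatim quotation of a PUBLISHED theorem with page
reference. The manuscript(s) under audit are NOT citable for their own disputed steps — they are the thing under adjudication; programme-internal
(2001/route/tribunal) claims are never citable.»  0 estimates; 0∕4 row-D1 binders (hW, hR, D1Tel, D1Rep); NOT (T-ID), NOT (C1), NOT SDF, NOT D1,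
NOT BetaPertH, NOT continuum, NOT Clay.  D1 formalisation swarm LEAF PROVER 02 (b2b-balaban-beta-d1-formalise-leaf-02 gen 32), 2026-08-24.  No existing file touched.
v1.1 (leaf-02 g33, 2026-08-25): §1's `tsum_mul_indicator_wrap` is READ BY NAME from the rooted R-9 `TorusCompositeInsertionKernel` instead of re-typed (the gate's `dedup.landed` is α-invariant across namespaces); §2 byte-identical to v1 17381dc9ccedcd19.
-/

noncomputable section

open scoped BigOperators

namespace Summit.QuantumFields.BalabanUV.Beta.FP.TorusCompositeInsertionKernelSym

open Matrix Finset
open Literature.MathematicalPhysics.QuantumFieldTheory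
open Literature.MathematicalPhysics.QuantumFieldTheory.Balaban1983to89
open Literature.MathematicalPhysics.QuantumFieldTheory.Balaban1983to89.Beta
open B5Prop11Plancherel (fine)
open B6Lemma24Torus (pbox mem_pbox wrap)
open B4TorusKernel.MultiPeriod (translate translate_apply)
open ExpKernelCalculus (MKer shiftK)
open AffineAveraging (Site Form1 box toSite)
open AveragingContoursRooted (ctr ctrOff)
open Summit.QuantumFields.BalabanUV.Beta.SymAveragingHessianCounts (symVhKerAt symLinKerAt)
open OneStepResolventKernel (Fib)
open Summit.QuantumFields.BalabanUV.Beta.BorderedHessian (stepScale)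
open Summit.QuantumFields.BalabanUV.Beta.GAN24.KernelPeriodisation (wrap_translate)
open Summit.QuantumFields.BalabanUV.Beta.FP.KernelPeriodisationFib (perZ perZ_apply)
open Summit.QuantumFields.BalabanUV.Beta.FP.KernelPeriodisationFibLoc (dper)
open Summit.QuantumFields.BalabanUV.Beta.FP.KernelPeriodisationFibTrace (tsum_sites_eq_sum_tsum)
open Summit.QuantumFields.BalabanUV.Beta.FP.PeriodisedBorderTables (dper_apply_of_blockCov)
open Summit.QuantumFields.BalabanUV.Beta.FP.TorusGaugeCovariancePairing (wrapPt wrapPt_coe wrapPt_of_mem)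
open Summit.QuantumFields.BalabanUV.Beta.FP.TorusCompositeObjects (towerTorus towerTorus_apply)
open Summit.QuantumFields.BalabanUV.Beta.FP.TorusCompositeCovarianceOneSym (compIns₁Sym)
open Summit.QuantumFields.BalabanUV.Beta.FP.TorusStepInsertionPeriodic (exists_finset_translate)
open Summit.QuantumFields.BalabanUV.Beta.FP.TorusStepInsertionPeriodicTwo (sum_mul_tsum_translate_eq_tsum_lift)
open Summit.QuantumFields.BalabanUV.Beta.FP.TorusCompositeInsertionPeriodicSym (compIns₁Sym_apply_eq)
open Summit.QuantumFields.BalabanUV.Beta.FP.TorusCompositeInsertionKernel (tsum_mul_indicator_wrap)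

variable {d : ℕ} (Lc : ℕ) [NeZero Lc]

/-! ## §1 Plumbing: a windowed lattice function against the periodic indicator of a torus site is its sum over the copies of the site -/

/-! ## §2 The kernel-level junction -/

/-- [folklore] **`sum_mul_perZ_dper_eq_compIns₁Sym_apply` — THE KERNEL-LEVEL (S3-2) FORM OF THE ORDER-1 SYM COMPOSITE JUNCTION.**  Letters: `hR0 ∕ hRsucc` — the sym
one-step law for the rows functional `𝓡`; `h0 ∕ hsucc` — OUR sym chain rule for `𝓘`; `hVt` — block covariance of `𝒱` at the tower's blocking `Lc^n`; `hS ∕ hT` — windows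
in the fluctuation slot and the family bond for a fixed multiplier site; `h𝒱` — the border entries of `𝒱` at the coarse multiplier sites are a kernel of `𝓘 lev n`.
Conclusion, at the centred tower, for every root list `rs`, every torus weight `h` and all slots:
`Σ_b h b · perZ T (dper T (𝒱 b.2 b.1)) (Lc^n • x̄) z (inr κ) (inl β) = compIns₁Sym Lc M lev rs n h (x̄, κ) (z, β)`, `T = towerTorus Lc M n`. -/
theorem sum_mul_perZ_dper_eq_compIns₁Sym_apply (hc : ctrOff (d + 1) Lc ∈ box (d + 1) Lc)
    (𝓡 : (ℕ → ℕ) → ℕ → Form1 (d + 1) ℝ → Form1 (d + 1) ℝ)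
    (hR0 : ∀ (lev : ℕ → ℕ) (B : Form1 (d + 1) ℝ), 𝓡 lev 0 B = B)
    (hRsucc : ∀ (lev : ℕ → ℕ) (n : ℕ) (B : Form1 (d + 1) ℝ) (κ : Fin (d + 1)) (x : Site (d + 1)),
      𝓡 lev (n + 1) B κ x = stepScale d Lc (lev 1) * ((Lc : ℝ) ^ (d + 1)
        * ∑' z : Site (d + 1), ∑ l : Fin (d + 1), symLinKerAt (ctr (d + 1) Lc) Lc κ x (l, z) * 𝓡 (fun k => lev (k + 1)) n B l z))
    (𝓘 : (ℕ → ℕ) → ℕ → Form1 (d + 1) ℝ → Form1 (d + 1) ℝ → Form1 (d + 1) ℝ)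
    (h0 : ∀ (lev : ℕ → ℕ) (H B : Form1 (d + 1) ℝ), 𝓘 lev 0 H B = 0)
    (hsucc : ∀ (lev : ℕ → ℕ) (n : ℕ) (H B : Form1 (d + 1) ℝ) (κ : Fin (d + 1)) (x : Site (d + 1)),
      𝓘 lev (n + 1) H B κ x
        = (((Lc : ℝ) ^ (d + 1) * stepScale d Lc (lev 1)) * (∏ i ∈ Finset.range n, (stepScale d Lc (lev (i + 1 + 1)) * ((box (d + 1) Lc).card : ℝ)))⁻¹) *
            (∑' u : Site (d + 1), ∑ κ' : Fin (d + 1),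
              (∑' z : Site (d + 1), ∑ l : Fin (d + 1), symVhKerAt (ctr (d + 1) Lc) Lc κ x (l, z) (κ', u) * 𝓡 (fun k => lev (k + 1)) n B l z) *
                𝓡 (fun k => lev (k + 1)) n H κ' u)
          + stepScale d Lc (lev 1) * ((Lc : ℝ) ^ (d + 1) *
              ∑' z : Site (d + 1), ∑ l : Fin (d + 1), symLinKerAt (ctr (d + 1) Lc) Lc κ x (l, z) * 𝓘 (fun k => lev (k + 1)) n H B l z))
    (n : ℕ) (M : Fin (d + 1) → ℕ) [∀ μ, NeZero (M μ)] (lev : ℕ → ℕ) (rs : ℕ → (Fin (d + 1) → ℕ))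
    (𝒱 : Fin (d + 1) → Site (d + 1) → MKer (d + 1) (Fib d)) (W : Site (d + 1) → Finset (Site (d + 1)))
    (hVt : ∀ (κ' : Fin (d + 1)) (u t : Site (d + 1)), 𝒱 κ' (u + (((Lc ^ n : ℕ) : ℤ)) • t) = shiftK (-((((Lc ^ n : ℕ) : ℤ)) • t)) (𝒱 κ' u))
    (hS : ∀ (κ' : Fin (d + 1)) (u x : Site (d + 1)) (μ α : Fin (d + 1)), ∀ z ∉ W x, 𝒱 κ' u x z (Sum.inr μ) (Sum.inl α) = 0)
    (hT : ∀ (κ' : Fin (d + 1)) (x z : Site (d + 1)) (μ α : Fin (d + 1)), ∀ u ∉ W x, 𝒱 κ' u x z (Sum.inr μ) (Sum.inl α) = 0)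
    (h𝒱 : ∀ (H B : Form1 (d + 1) ℝ) (κ : Fin (d + 1)) (x : Site (d + 1)),
      (∑' u : Site (d + 1), ∑ κ' : Fin (d + 1),
        (∑' z : Site (d + 1), ∑ l : Fin (d + 1), 𝒱 κ' u ((((Lc ^ n : ℕ) : ℤ)) • x) z (Sum.inr κ) (Sum.inl l) * B l z) * H κ' u) = 𝓘 lev n H B κ x)
    (h : ↥(pbox (towerTorus Lc M n)) × Fin (d + 1) → ℝ) (x : ↥(pbox M)) (κ : Fin (d + 1)) (z : ↥(pbox (towerTorus Lc M n))) (β : Fin (d + 1)) :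
    ∑ b : ↥(pbox (towerTorus Lc M n)) × Fin (d + 1), h b *
        perZ (towerTorus Lc M n) (dper (towerTorus Lc M n) (𝒱 b.2 (b.1 : Site (d + 1)))) ((((Lc ^ n : ℕ) : ℤ)) • (x : Site (d + 1))) (z : Site (d + 1))
          (Sum.inr κ) (Sum.inl β)
      = compIns₁Sym Lc M lev rs n h (x, κ) (z, β) := by
  classical
  have hM : ∀ i, towerTorus Lc M n i = Lc ^ n * M i := fun i => towerTorus_apply Lc M n i
  -- the torus member of the bond `(κ′, u)`, entrywise: the double copy sum (family bond by covariance, fluctuation site by `perZ`)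
  have hentry : ∀ (κ' : Fin (d + 1)) (u : Site (d + 1)),
      perZ (towerTorus Lc M n) (dper (towerTorus Lc M n) (𝒱 κ' u)) ((((Lc ^ n : ℕ) : ℤ)) • (x : Site (d + 1))) (z : Site (d + 1)) (Sum.inr κ) (Sum.inl β)
        = ∑' m' : Site (d + 1), ∑' m : Site (d + 1),
            𝒱 κ' (translate (towerTorus Lc M n) u m') ((((Lc ^ n : ℕ) : ℤ)) • (x : Site (d + 1))) (translate (towerTorus Lc M n) (z : Site (d + 1)) m)
              (Sum.inr κ) (Sum.inl β) := fun κ' u => by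
    rw [perZ_apply]
    -- each `perZ` summand is the copy sum over the family bond; both sums are finite: swap
    obtain ⟨Fm, hFm⟩ := exists_finset_translate (towerTorus Lc M n) (W ((((Lc ^ n : ℕ) : ℤ)) • (x : Site (d + 1)))) (z : Site (d + 1))
    obtain ⟨Fm', hFm'⟩ := exists_finset_translate (towerTorus Lc M n) (W ((((Lc ^ n : ℕ) : ℤ)) • (x : Site (d + 1)))) u
    have hcopy : ∀ m : Site (d + 1), dper (towerTorus Lc M n) (𝒱 κ' u) ((((Lc ^ n : ℕ) : ℤ)) • (x : Site (d + 1)))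
        (translate (towerTorus Lc M n) (z : Site (d + 1)) m) (Sum.inr κ) (Sum.inl β)
          = ∑ m' ∈ Fm', 𝒱 κ' (translate (towerTorus Lc M n) u m') ((((Lc ^ n : ℕ) : ℤ)) • (x : Site (d + 1)))
              (translate (towerTorus Lc M n) (z : Site (d + 1)) m) (Sum.inr κ) (Sum.inl β) := fun m => by
      rw [dper_apply_of_blockCov hM hVt κ' u]
      exact tsum_eq_sum fun m' hm' => hT κ' _ _ κ β _ (hFm' m' hm')
    have hin : ∀ m' : Site (d + 1), (∑' m : Site (d + 1), 𝒱 κ' (translate (towerTorus Lc M n) u m') ((((Lc ^ n : ℕ) : ℤ)) • (x : Site (d + 1))) (translate (towerTorus Lc M n) (z : Site (d + 1)) m) (Sum.inr κ) (Sum.inl β))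
        = ∑ m ∈ Fm, 𝒱 κ' (translate (towerTorus Lc M n) u m') ((((Lc ^ n : ℕ) : ℤ)) • (x : Site (d + 1))) (translate (towerTorus Lc M n) (z : Site (d + 1)) m) (Sum.inr κ) (Sum.inl β) := fun m' =>
      tsum_eq_sum fun m hm => hS κ' _ _ κ β _ (hFm m hm)
    calc (∑' m : Site (d + 1), dper (towerTorus Lc M n) (𝒱 κ' u) ((((Lc ^ n : ℕ) : ℤ)) • (x : Site (d + 1))) (translate (towerTorus Lc M n) (z : Site (d + 1)) m) (Sum.inr κ) (Sum.inl β))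
        = ∑' m : Site (d + 1), ∑ m' ∈ Fm', 𝒱 κ' (translate (towerTorus Lc M n) u m') ((((Lc ^ n : ℕ) : ℤ)) • (x : Site (d + 1))) (translate (towerTorus Lc M n) (z : Site (d + 1)) m) (Sum.inr κ) (Sum.inl β) := tsum_congr hcopy
      _ = ∑ m ∈ Fm, ∑ m' ∈ Fm', 𝒱 κ' (translate (towerTorus Lc M n) u m') ((((Lc ^ n : ℕ) : ℤ)) • (x : Site (d + 1))) (translate (towerTorus Lc M n) (z : Site (d + 1)) m) (Sum.inr κ) (Sum.inl β) :=
          tsum_eq_sum fun m hm => Finset.sum_eq_zero fun m' _ => hS κ' _ _ κ β _ (hFm m hm)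
      _ = ∑ m' ∈ Fm', ∑ m ∈ Fm, 𝒱 κ' (translate (towerTorus Lc M n) u m') ((((Lc ^ n : ℕ) : ℤ)) • (x : Site (d + 1))) (translate (towerTorus Lc M n) (z : Site (d + 1)) m) (Sum.inr κ) (Sum.inl β) := Finset.sum_comm
      _ = ∑' m' : Site (d + 1), ∑ m ∈ Fm, 𝒱 κ' (translate (towerTorus Lc M n) u m') ((((Lc ^ n : ℕ) : ℤ)) • (x : Site (d + 1))) (translate (towerTorus Lc M n) (z : Site (d + 1)) m) (Sum.inr κ) (Sum.inl β) :=
          (tsum_eq_sum fun m' hm' => Finset.sum_eq_zero fun m _ => hT κ' _ _ κ β _ (hFm' m' hm')).symm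
      _ = ∑' m' : Site (d + 1), ∑' m : Site (d + 1), 𝒱 κ' (translate (towerTorus Lc M n) u m') ((((Lc ^ n : ℕ) : ℤ)) • (x : Site (d + 1))) (translate (towerTorus Lc M n) (z : Site (d + 1)) m) (Sum.inr κ) (Sum.inl β) := tsum_congr fun m' => (hin m').symm
  -- the copy sum in the fluctuation site is `𝒱` against the periodic indicator of the torus bond `(z, β)`
  have hind : ∀ (κ' : Fin (d + 1)) (u : Site (d + 1)),
      (∑' m : Site (d + 1), 𝒱 κ' u ((((Lc ^ n : ℕ) : ℤ)) • (x : Site (d + 1))) (translate (towerTorus Lc M n) (z : Site (d + 1)) m) (Sum.inr κ) (Sum.inl β))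
        = ∑' z' : Site (d + 1), ∑ l : Fin (d + 1), 𝒱 κ' u ((((Lc ^ n : ℕ) : ℤ)) • (x : Site (d + 1))) z' (Sum.inr κ) (Sum.inl l) *
            (fun l w => KKTFluctuationKernel.delta1 β (z : Site (d + 1)) l (wrap (towerTorus Lc M n) w)) l z' := fun κ' u => by
    have hsingle : ∀ z' : Site (d + 1), ∑ l : Fin (d + 1), 𝒱 κ' u ((((Lc ^ n : ℕ) : ℤ)) • (x : Site (d + 1))) z' (Sum.inr κ) (Sum.inl l) *
        (fun l w => KKTFluctuationKernel.delta1 β (z : Site (d + 1)) l (wrap (towerTorus Lc M n) w)) l z'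
          = 𝒱 κ' u ((((Lc ^ n : ℕ) : ℤ)) • (x : Site (d + 1))) z' (Sum.inr κ) (Sum.inl β) *
              (if wrap (towerTorus Lc M n) z' = (z : Site (d + 1)) then (1 : ℝ) else 0) := fun z' => by
      have hl : ∀ l : Fin (d + 1), 𝒱 κ' u ((((Lc ^ n : ℕ) : ℤ)) • (x : Site (d + 1))) z' (Sum.inr κ) (Sum.inl l) *
          (fun l w => KKTFluctuationKernel.delta1 β (z : Site (d + 1)) l (wrap (towerTorus Lc M n) w)) l z'
            = if l = β then 𝒱 κ' u ((((Lc ^ n : ℕ) : ℤ)) • (x : Site (d + 1))) z' (Sum.inr κ) (Sum.inl β) *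
                (if wrap (towerTorus Lc M n) z' = (z : Site (d + 1)) then (1 : ℝ) else 0) else 0 := fun l => by
        show _ * KKTFluctuationKernel.delta1 β _ l (wrap _ z') = _
        rw [KKTFluctuationKernel.delta1_apply]
        by_cases hl : l = β
        · subst hl; simp
        · rw [if_neg (fun hc => hl hc.1), if_neg hl, mul_zero]
      rw [Finset.sum_congr rfl fun l _ => hl l, Finset.sum_ite_eq' Finset.univ β]
      simp only [Finset.mem_univ, if_true]
    rw [tsum_congr hsingle]
    exact (tsum_mul_indicator_wrap (towerTorus Lc M n) _ (W ((((Lc ^ n : ℕ) : ℤ)) • (x : Site (d + 1))))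
      (fun z' hz' => hS κ' u _ κ β z' hz') z).symm
  -- the family-bond copies: finitely many load the block of `x̄`
  have hF0 : ∀ (κ' : Fin (d + 1)), ∀ u ∉ W ((((Lc ^ n : ℕ) : ℤ)) • (x : Site (d + 1))),
      (∑' m : Site (d + 1), 𝒱 κ' u ((((Lc ^ n : ℕ) : ℤ)) • (x : Site (d + 1))) (translate (towerTorus Lc M n) (z : Site (d + 1)) m) (Sum.inr κ) (Sum.inl β)) = 0 :=
    fun κ' u hu => (tsum_congr fun m => hT κ' _ _ κ β u hu).trans tsum_zero
  -- assemble: entries ↦ (lift engine) ↦ `h𝒱` at the periodic indicator ↦ `compIns₁Sym_apply_eq`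
  calc ∑ b : ↥(pbox (towerTorus Lc M n)) × Fin (d + 1), h b *
          perZ (towerTorus Lc M n) (dper (towerTorus Lc M n) (𝒱 b.2 (b.1 : Site (d + 1)))) ((((Lc ^ n : ℕ) : ℤ)) • (x : Site (d + 1))) (z : Site (d + 1))
            (Sum.inr κ) (Sum.inl β)
      = ∑ b : ↥(pbox (towerTorus Lc M n)) × Fin (d + 1), h b * ∑' m' : Site (d + 1),
          (fun κ' u => ∑' m : Site (d + 1), 𝒱 κ' u ((((Lc ^ n : ℕ) : ℤ)) • (x : Site (d + 1))) (translate (towerTorus Lc M n) (z : Site (d + 1)) m)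
            (Sum.inr κ) (Sum.inl β)) b.2 (translate (towerTorus Lc M n) (b.1 : Site (d + 1)) m') :=
        Finset.sum_congr rfl fun b _ => by rw [hentry]
    _ = ∑' u : Site (d + 1), ∑ κ' : Fin (d + 1),
          (∑' m : Site (d + 1), 𝒱 κ' u ((((Lc ^ n : ℕ) : ℤ)) • (x : Site (d + 1))) (translate (towerTorus Lc M n) (z : Site (d + 1)) m) (Sum.inr κ) (Sum.inl β))
            * h (wrapPt (towerTorus Lc M n) u, κ') :=
        sum_mul_tsum_translate_eq_tsum_lift (towerTorus Lc M n) _ _ hF0 h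
    _ = ∑' u : Site (d + 1), ∑ κ' : Fin (d + 1),
          (∑' z' : Site (d + 1), ∑ l : Fin (d + 1), 𝒱 κ' u ((((Lc ^ n : ℕ) : ℤ)) • (x : Site (d + 1))) z' (Sum.inr κ) (Sum.inl l) *
            (fun l w => KKTFluctuationKernel.delta1 β (z : Site (d + 1)) l (wrap (towerTorus Lc M n) w)) l z')
            * (fun l w => h (wrapPt (towerTorus Lc M n) w, l)) κ' u :=
        tsum_congr fun u => Finset.sum_congr rfl fun κ' _ => by rw [hind]
    _ = 𝓘 lev n (fun l w => h (wrapPt (towerTorus Lc M n) w, l))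
          (fun l w => KKTFluctuationKernel.delta1 β (z : Site (d + 1)) l (wrap (towerTorus Lc M n) w)) κ (x : Site (d + 1)) := h𝒱 _ _ κ _
    _ = compIns₁Sym Lc M lev rs n h (x, κ) (z, β) := (compIns₁Sym_apply_eq Lc hc 𝓡 hR0 hRsucc 𝓘 h0 hsucc n M lev rs h x κ z β).symm

end Summit.QuantumFields.BalabanUV.Beta.FP.TorusCompositeInsertionKernelSym

end
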